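import Literature.Computability.QuantumComplexity.LightConeAmp
import Literature.Computability.QuantumComplexity.StateVectorDP
import Literature.Computability.QuantumComplexity.StabilizerSimulation
import HarnessLib

/-!
# A kernel-executable Clifford+`T` state-vector simulator over `ℤ[ω]`, and `χ(|T⟩^{⊗6}) ≤ 7`

Topic `Literature/Computability/QuantumComplexity`. This file serves the discharge of the named
fact `BravyiSmithSmolin2016_stabilizerRank_magicT_pow_six` (`StabilizerSimulation.lean`):
the stabilizer rank of six copies of the magic state `|T⟩ = T H |0⟩` is at most `7`
(Bravyi–Smith–Smolin 2016, §IV eq. (11): an explicit seven-term stabilizer decomposition of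
`|H⟩^{⊗6}`, `|H⟩ = |0⟩ + (√2 - 1)|1⟩` being Clifford-equivalent to `|T⟩`). The decomposition is
a finite identity between vectors of `ℂ^{64}` with entries in `ℚ(ω)`, `ω = e^{iπ/4}`; we check it
by **computation inside the kernel** (`decide`), which needs a computable replica of the tree's
(noncomputable, `ℂ`-valued) circuit semantics together with a proof that the replica is faithful:

* `CliffordSim.Vec n` — dense `n`-qubit state vectors with amplitudes in `ℤ[ω]` (the coordinate
  quadruples `LightCone.Amp` of `LightConeAmp.lean`, here completed by the product `Amp.mul`),
  stored as complete binary trees (the last qubit split at the root); `Vec.eval v x` is the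
  amplitude of the basis label `x : Fin n → Bool` and `Vec.toState v : QReg n → ℂ` the complex
  vector `x ↦ Σ cₖ ωᵏ`;
* the gates in the Schrödinger picture on trees: `applyH` (the *scaled* Hadamard
  `√2·H = [[1,1],[1,-1]]`, which keeps amplitudes integral), `applyS`, `applyT`, `applyCX`, with
  their pointwise semantics (`eval_applyH`, …) and the **faithfulness theorem** `toState_run`:
  for a word `ops` over `H, S, T, CNOT` (`CliffordSim.Op`, interpreted in the tree by
  `hOn/sOn/tOn/cnotOn`), `toState (run ops v) = √2^{#H} • (circuit ops).toMatrix A *ᵥ toState v`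
  — proved from the pull-form gate actions `LightCone.semZeta_mulVec_apply_H/S/T/CNOT`;
* `exists_stabilizer`: a `T`-free word applied to the vacuum tree yields `√2^{#H}` times a
  stabilizer state of `StabilizerRank.lean` (`cliffordCircuits`, `stabilizerStates`);
* `toState_magic`: the tree `magic n` with entries `ω^{|x|}` is `√2^n • |T⟩^{⊗n}`
  (`tensorPow magicT n`);
* `BSS.identity` — **the seven-term identity**, decided by the kernel:
  `2^{10} • magic 6 = Σ_{i<7} dᵢ • run (BSS.ops i) |0^6⟩` with `dᵢ ∈ ℤ[ω]` and seven Clifford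
  words preparing (the images under the local Clifford `(H S³)^{⊗6}` of) the states
  `|B_{6,0}⟩, |B_{6,6}⟩, |E_6⟩, |O_6⟩, Z^{⊗6}|K_6⟩, |φ'⟩, |φ''⟩` of Bravyi–Smith–Smolin's eq. (11)
  (the graphs `G'`, `G''` of their Fig. 2 are the 5-wheels with hub `6`, rim `1-2-3-4-5`, resp.
  hub `3`, rim `1-2-4-5-6`); whence `BSS.magicT_pow_six_decomposition`:
  `|T⟩^{⊗6} = Σ_{i<7} cᵢ φᵢ` with stabilizer states `φᵢ`, and the discharge
  `BravyiSmithSmolin2016_stabilizerRank_magicT_pow_six_holds : χ(|T⟩^{⊗6}) ≤ 7`.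

## Proof sketch of the decomposition (Bravyi–Smith–Smolin 2016, §IV)

With `t = tan(π/8) = √2 - 1` and `|H⟩ = |0⟩ + t|1⟩`, eq. (11) reads
`|H^{⊗6}⟩ = (-16+12√2)|B_{6,0}⟩ + (96-68√2)|B_{6,6}⟩ + (10-7√2)|E_6⟩ + (-14+10√2)|O_6⟩
  + (7-5√2) Z^{⊗6}|K_6⟩ + (10-7√2)|φ'⟩ + (10-7√2)|φ''⟩`,
where `|S⟩ = Σ_{x ∈ S} |x⟩` for a set of bit strings, `E_6`/`O_6` are the even/odd-weight strings,
`|K_6⟩ = ∏_{i<j} CZ_{ij} |B_6⟩` and `|φ'⟩ = ∏_{(i,j) ∈ E'} CZ_{ij} |O_6⟩`,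
`|φ''⟩ = ∏_{(i,j) ∈ E''} CZ_{ij} |O_6⟩`. Since `|T⟩ = ((1+ω)/2) · H S³ |H⟩`, applying
`(H S³)^{⊗6}` gives a seven-term stabilizer decomposition of `|T⟩^{⊗6}`. All seven states are
prepared from `|0^6⟩` by words over `H, S, CNOT` (`X = HSSH`, `Z = SS`, `CZ_{ij} = H_j CNOT_{ij} H_j`);
in the scaled arithmetic of this file (`H ↦ √2 H`) every amplitude and coefficient lies in
`ℤ[ω]`, and the identity is checked exactly on all `64` amplitudes.

## References

* S. Bravyi, G. Smith, J. A. Smolin, *Trading classical and quantum computational resources*,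
  Phys. Rev. X 6 (2016) 021043, arXiv:1506.01396: §IV, eq. (11) and Fig. 2 (the graphs `G'`,
  `G''`); §I (`χ₆ ≤ 7`).
* M. A. Nielsen, I. L. Chuang, *Quantum Computation and Quantum Information*, CUP 2010, §4.2
  (actions of `H`, `S`, `T`, `CNOT`; `X = HZH`, Ex. 4.18), §4.5.5 (simulation by storing the `2ⁿ`
  amplitudes), §10.5.1 (stabilizer states).
* S. Aaronson, D. Gottesman, *Improved simulation of stabilizer circuits*, PRA 70 (2004) 052328,
  §I (stabilizer states = Clifford circuits on `|0ⁿ⟩`).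

## Design notes

* Everything that `decide` must evaluate is first-order data (integer quadruples, binary trees,
  lists of gate symbols) defined by structural recursion; no function-typed states, no `Finset`
  sums, no well-founded recursion. The complex semantics enters only through `Vec.toState` and
  the faithfulness lemmas, which are generic in the number of qubits.
* Wire indices inside the executable layer are naturals compared with the tree depth; the
  semantic lemmas are stated for `k : Fin n`.
* The identity is stated with the global factor `2^{10}` so that all coefficients are in `ℤ[ω]`
  (`√2 = ω - ω³`); the complex coefficients of the final decomposition are not simplified.
-/

noncomputable section

namespace Literature.Computability.QuantumComplexity

open _root_.Computability Complexity Cryptography Matrix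

/-! ### The product on `ℤ[ω]` in coordinates -/

namespace LightCone.Amp

/-- The product of `ℤ[ω]` in coordinates: convolution of `(a₀,a₁,a₂,a₃)` and `(b₀,b₁,b₂,b₃)`
with `ω⁴ = -1`. [folklore] -/
def mul (a b : Amp) : Amp :=
  ⟨a.c0 * b.c0 - a.c1 * b.c3 - a.c2 * b.c2 - a.c3 * b.c1,
   a.c0 * b.c1 + a.c1 * b.c0 - a.c2 * b.c3 - a.c3 * b.c2,
   a.c0 * b.c2 + a.c1 * b.c1 + a.c2 * b.c0 - a.c3 * b.c3,
   a.c0 * b.c3 + a.c1 * b.c2 + a.c2 * b.c1 + a.c3 * b.c0⟩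

/-- The value of a product is the product of the values, for `ζ⁴ = -1`. [folklore] -/
theorem eval_mul {ζ : ℂ} (hζ : ζ ^ 4 = -1) (a b : Amp) : eval ζ (mul a b) = eval ζ a * eval ζ b := by
  simp only [eval, mul, Int.cast_add, Int.cast_sub, Int.cast_mul]
  linear_combination (-((a.c1 * b.c3 + a.c2 * b.c2 + a.c3 * b.c1 : ℂ) +
    (a.c2 * b.c3 + a.c3 * b.c2 : ℂ) * ζ + (a.c3 * b.c3 : ℂ) * ζ ^ 2)) * hζ

end LightCone.Amp

namespace CliffordSim

open LightCone

/-! ### Dense state vectors over `ℤ[ω]` as complete binary trees -/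

/-- Dense `n`-qubit state vectors with amplitudes in `ℤ[ω]` (coordinate quadruples `Amp`): a
complete binary tree of depth `n`, the two subtrees of a node being the halves on which the
*last* qubit reads `0` resp. `1`. (Nielsen–Chuang 2010, §4.5.5: store all `2ⁿ` amplitudes.)
[folklore] -/
inductive Vec : ℕ → Type
  | leaf : Amp → Vec 0
  | node {n : ℕ} : Vec n → Vec n → Vec (n + 1)
  deriving DecidableEq

namespace Vec

variable {n : ℕ}

/-- The amplitude of the basis label `x`. [folklore] -/
def eval : {n : ℕ} → Vec n → (Fin n → Bool) → Amp
  | _, leaf a, _ => a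
  | n + 1, node v₀ v₁, x => if x (Fin.last n) then v₁.eval (Fin.init x) else v₀.eval (Fin.init x)

/-- Apply a function to every amplitude. [folklore] -/
def map (f : Amp → Amp) : {n : ℕ} → Vec n → Vec n
  | _, leaf a => leaf (f a)
  | _, node v₀ v₁ => node (map f v₀) (map f v₁)

/-- Combine two vectors amplitude-wise. [folklore] -/
def zipWith (f : Amp → Amp → Amp) : {n : ℕ} → Vec n → Vec n → Vec n
  | _, leaf a, leaf b => leaf (f a b)
  | _, node u₀ u₁, node v₀ v₁ => node (zipWith f u₀ v₀) (zipWith f u₁ v₁)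

/-- Amplitude-wise sum. [folklore] -/
instance : Add (Vec n) := ⟨zipWith (· + ·)⟩

/-- Scalar multiple by an element of `ℤ[ω]`. [folklore] -/
def smul (a : Amp) (v : Vec n) : Vec n := v.map (Amp.mul a)

/-- The zero vector. [folklore] -/
def zero : (n : ℕ) → Vec n
  | 0 => leaf 0
  | n + 1 => node (zero n) (zero n)

/-- The vacuum `|0ⁿ⟩`. [folklore] -/
def vac : (n : ℕ) → Vec n
  | 0 => leaf 1
  | n + 1 => node (vac n) (zero n)

/-- The vector with amplitudes `ω^{|x|}`, i.e. `√2ⁿ |T⟩^{⊗n}` (`toState_magic`).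
[Bravyi–Gosset 2016; Bravyi–Smith–Smolin 2016, §IV] [folklore] -/
def magic : (n : ℕ) → Vec n
  | 0 => leaf 1
  | n + 1 => node (magic n) ((magic n).map Amp.mulOmega)

/-- The scaled Hadamard gate `√2·H = [[1,1],[1,-1]]` on wire `k` (no-op if `k ≥ n`).
[Nielsen–Chuang 2010, §4.2] [folklore] -/
def applyH : {n : ℕ} → ℕ → Vec n → Vec n
  | 0, _, v => v
  | n + 1, k, node v₀ v₁ =>
    if k = n then node (zipWith (· + ·) v₀ v₁) (zipWith (fun a b => a + -b) v₀ v₁)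
    else node (applyH k v₀) (applyH k v₁)

/-- The phase gate `S = diag(1, i)` on wire `k` (`i = ω²`). [Nielsen–Chuang 2010, §4.2] [folklore] -/
def applyS : {n : ℕ} → ℕ → Vec n → Vec n
  | 0, _, v => v
  | n + 1, k, node v₀ v₁ =>
    if k = n then node v₀ (v₁.map fun a => Amp.mulOmega (Amp.mulOmega a))
    else node (applyS k v₀) (applyS k v₁)

/-- The gate `T = diag(1, ω)` on wire `k`. [Nielsen–Chuang 2010, §4.2] [folklore] -/
def applyT : {n : ℕ} → ℕ → Vec n → Vec n
  | 0, _, v => v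
  | n + 1, k, node v₀ v₁ =>
    if k = n then node v₀ (v₁.map Amp.mulOmega) else node (applyT k v₀) (applyT k v₁)

/-- The NOT gate on wire `k` (used for `CNOT` with control on the last wire). [folklore] -/
def applyX : {n : ℕ} → ℕ → Vec n → Vec n
  | 0, _, v => v
  | n + 1, k, node v₀ v₁ => if k = n then node v₁ v₀ else node (applyX k v₀) (applyX k v₁)

/-- `mix c u w`: the vector agreeing with `u` where wire `c` reads `0` and with `w` where it
reads `1`. [folklore] -/
def mix : {n : ℕ} → ℕ → Vec n → Vec n → Vec n
  | 0, _, u, _ => u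
  | n + 1, c, node u₀ u₁, node w₀ w₁ =>
    if c = n then node u₀ w₁ else node (mix c u₀ w₀) (mix c u₁ w₁)

/-- The `CNOT` gate with control wire `c` and target wire `t`. [Nielsen–Chuang 2010, §1.3.2]
[folklore] -/
def applyCX : {n : ℕ} → ℕ → ℕ → Vec n → Vec n
  | 0, _, _, v => v
  | n + 1, c, t, node v₀ v₁ =>
    if c = n then node v₀ (applyX t v₁)
    else if t = n then node (mix c v₀ v₁) (mix c v₁ v₀)
    else node (applyCX c t v₀) (applyCX c t v₁)

/-! ### Pointwise semantics of the tree operations -/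

/-- Amplitudes of a leaf. [folklore] -/
@[simp] theorem eval_leaf (a : Amp) (x : Fin 0 → Bool) : (leaf a).eval x = a := rfl

/-- Amplitudes of a node: branch on the last qubit. [folklore] -/
@[simp] theorem eval_node (v₀ v₁ : Vec n) (x : Fin (n + 1) → Bool) :
    (node v₀ v₁).eval x = if x (Fin.last n) then v₁.eval (Fin.init x) else v₀.eval (Fin.init x) := rfl

/-- `map` acts amplitude-wise. [folklore] -/
theorem eval_map (f : Amp → Amp) : ∀ {n : ℕ} (v : Vec n) (x : Fin n → Bool), (v.map f).eval x = f (v.eval x)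
  | _, leaf a, x => rfl
  | _, node v₀ v₁, x => by
    simp only [map, eval_node, eval_map f v₀, eval_map f v₁]
    split <;> rfl

/-- `zipWith` acts amplitude-wise. [folklore] -/
theorem eval_zipWith (f : Amp → Amp → Amp) :
    ∀ {n : ℕ} (u v : Vec n) (x : Fin n → Bool), (zipWith f u v).eval x = f (u.eval x) (v.eval x)
  | _, leaf a, leaf b, x => rfl
  | _, node u₀ u₁, node v₀ v₁, x => by
    simp only [zipWith, eval_node, eval_zipWith f u₀ v₀, eval_zipWith f u₁ v₁]
    split <;> rfl

/-- Sum, amplitude-wise. [folklore] -/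
theorem eval_add (u v : Vec n) (x : Fin n → Bool) : (u + v).eval x = u.eval x + v.eval x :=
  eval_zipWith _ u v x

/-- Scalar multiple, amplitude-wise. [folklore] -/
theorem eval_smul (a : Amp) (v : Vec n) (x : Fin n → Bool) : (smul a v).eval x = Amp.mul a (v.eval x) :=
  eval_map _ v x

/-- The zero vector has zero amplitudes. [folklore] -/
theorem eval_zero : ∀ {n : ℕ} (x : Fin n → Bool), (zero n).eval x = 0
  | 0, _ => rfl
  | n + 1, x => by
    simp only [zero, eval_node, eval_zero (Fin.init x)]
    split <;> rfl

/-- A label is all-`0` iff its last bit is `0` and its initial part is all-`0`. [folklore] -/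
theorem eq_allFalse_iff (x : Fin (n + 1) → Bool) :
    (x = fun _ => false) ↔ x (Fin.last n) = false ∧ Fin.init x = fun _ => false := by
  constructor
  · rintro rfl
    exact ⟨rfl, rfl⟩
  · rintro ⟨hl, hi⟩
    funext i
    refine Fin.lastCases hl (fun j => ?_) i
    exact congrFun hi j

/-- Amplitudes of the vacuum: `1` at the all-`0` label, `0` elsewhere. [folklore] -/
theorem eval_vac : ∀ {n : ℕ} (x : Fin n → Bool), (vac n).eval x = if x = (fun _ => false) then 1 else 0
  | 0, x => by
    rw [if_pos (Subsingleton.elim _ _)]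
    rfl
  | n + 1, x => by
    rw [vac, eval_node, eval_zero, eval_vac (Fin.init x)]
    by_cases hx : x = fun _ => false
    · rw [if_pos hx, if_neg (by rw [hx]; exact Bool.false_ne_true), if_pos ((eq_allFalse_iff x).1 hx).2]
    · rw [if_neg hx]
      split_ifs with h1 h2
      · rfl
      · exact absurd ((eq_allFalse_iff x).2 ⟨Bool.eq_false_iff.2 h1, h2⟩) hx
      · rfl

/-- Amplitudes of `magic`: multiplying by `ω` for every `1` of the label. [folklore] -/
theorem eval_magic_succ (x : Fin (n + 1) → Bool) :
    (magic (n + 1)).eval x =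
      if x (Fin.last n) then Amp.mulOmega ((magic n).eval (Fin.init x)) else (magic n).eval (Fin.init x) := by
  rw [magic, eval_node, eval_map]

/-- **Scaled Hadamard, pointwise**: `(√2 H_k v)(x) = v(x[k↦0]) ± v(x[k↦1])`.
[Nielsen–Chuang 2010, §4.2] [folklore] -/
theorem eval_applyH : ∀ {n : ℕ} (k : Fin n) (v : Vec n) (x : Fin n → Bool),
    (v.applyH k).eval x =
      if x k then v.eval (Function.update x k false) + -v.eval (Function.update x k true)
      else v.eval (Function.update x k false) + v.eval (Function.update x k true)
  | 0, k, _, _ => k.elim0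
  | n + 1, k, node v₀ v₁, x => by
    cases k using Fin.lastCases with
    | last =>
      simp [applyH, eval_zipWith, Fin.init_update_last]
    | cast k =>
      have hne : (k : ℕ) ≠ n := Nat.ne_of_lt k.isLt
      have hlast : (Fin.last n) ≠ k.castSucc := (Fin.castSucc_lt_last k).ne'
      simp only [applyH, Fin.val_castSucc, hne, if_false, eval_node, eval_applyH k, Fin.init_update_castSucc,
        Function.update_of_ne hlast, Fin.init]
      split_ifs <;> rfl

/-- **Phase gate, pointwise**: `(S_k v)(x) = i^{x_k} v(x)` (`i = ω·ω`). [Nielsen–Chuang 2010, §4.2]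
[folklore] -/
theorem eval_applyS : ∀ {n : ℕ} (k : Fin n) (v : Vec n) (x : Fin n → Bool),
    (v.applyS k).eval x = if x k then Amp.mulOmega (Amp.mulOmega (v.eval x)) else v.eval x
  | 0, k, _, _ => k.elim0
  | n + 1, k, node v₀ v₁, x => by
    cases k using Fin.lastCases with
    | last =>
      simp only [applyS, Fin.val_last, if_true, eval_node, eval_map]
      split_ifs <;> rfl
    | cast k =>
      have hne : (k : ℕ) ≠ n := Nat.ne_of_lt k.isLt
      simp only [applyS, Fin.val_castSucc, hne, if_false, eval_node, eval_applyS k, Fin.init]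
      split_ifs <;> rfl

/-- **`T` gate, pointwise**: `(T_k v)(x) = ω^{x_k} v(x)`. [Nielsen–Chuang 2010, §4.2] [folklore] -/
theorem eval_applyT : ∀ {n : ℕ} (k : Fin n) (v : Vec n) (x : Fin n → Bool),
    (v.applyT k).eval x = if x k then Amp.mulOmega (v.eval x) else v.eval x
  | 0, k, _, _ => k.elim0
  | n + 1, k, node v₀ v₁, x => by
    cases k using Fin.lastCases with
    | last =>
      simp only [applyT, Fin.val_last, if_true, eval_node, eval_map]
      split_ifs <;> rfl
    | cast k =>
      have hne : (k : ℕ) ≠ n := Nat.ne_of_lt k.isLt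
      simp only [applyT, Fin.val_castSucc, hne, if_false, eval_node, eval_applyT k, Fin.init]
      split_ifs <;> rfl

/-- **NOT gate, pointwise**: `(X_k v)(x) = v(x[k ↦ ¬x_k])`. [Nielsen–Chuang 2010, §1.3.1] [folklore] -/
theorem eval_applyX : ∀ {n : ℕ} (k : Fin n) (v : Vec n) (x : Fin n → Bool),
    (v.applyX k).eval x = v.eval (Function.update x k (!x k))
  | 0, k, _, _ => k.elim0
  | n + 1, k, node v₀ v₁, x => by
    cases k using Fin.lastCases with
    | last =>
      simp only [applyX, Fin.val_last, if_true, eval_node, Function.update_self, Fin.init_update_last]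
      cases x (Fin.last n) <;> rfl
    | cast k =>
      have hne : (k : ℕ) ≠ n := Nat.ne_of_lt k.isLt
      have hlast : (Fin.last n) ≠ k.castSucc := (Fin.castSucc_lt_last k).ne'
      simp only [applyX, Fin.val_castSucc, hne, if_false, eval_node, eval_applyX k, Fin.init_update_castSucc,
        Function.update_of_ne hlast, Fin.init]

/-- **`mix`, pointwise**: `(mix c u w)(x) = (x_c ? w : u)(x)`. [folklore] -/
theorem eval_mix : ∀ {n : ℕ} (c : Fin n) (u w : Vec n) (x : Fin n → Bool),
    (mix c u w).eval x = if x c then w.eval x else u.eval x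
  | 0, c, _, _, _ => c.elim0
  | n + 1, c, node u₀ u₁, node w₀ w₁, x => by
    cases c using Fin.lastCases with
    | last =>
      simp only [mix, Fin.val_last, if_true, eval_node]
      split_ifs <;> rfl
    | cast c =>
      have hne : (c : ℕ) ≠ n := Nat.ne_of_lt c.isLt
      simp only [mix, Fin.val_castSucc, hne, if_false, eval_node, eval_mix c, Fin.init]
      split_ifs <;> rfl

/-- **`CNOT`, pointwise**: `(CNOT_{c,t} v)(x) = v(x[t ↦ x_t ⊕ x_c])` (`c ≠ t`).
[Nielsen–Chuang 2010, §1.3.2] [folklore] -/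
theorem eval_applyCX : ∀ {n : ℕ} (c t : Fin n) (_ : c ≠ t) (v : Vec n) (x : Fin n → Bool),
    (v.applyCX c t).eval x = v.eval (Function.update x t (x t ^^ x c))
  | 0, c, _, _, _, _ => c.elim0
  | n + 1, c, t, hct, node v₀ v₁, x => by
    cases c using Fin.lastCases with
    | last =>
      cases t using Fin.lastCases with
      | last => exact absurd rfl hct
      | cast t =>
        have hlast : (Fin.last n) ≠ t.castSucc := (Fin.castSucc_lt_last t).ne'
        simp only [applyCX, Fin.val_last, if_true, eval_node, Fin.val_castSucc, eval_applyX t,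
          Fin.init_update_castSucc, Function.update_of_ne hlast, Fin.init]
        cases x (Fin.last n)
        · simp only [Bool.false_eq_true, if_false, Bool.xor_false]
          exact congrArg v₀.eval (Function.update_eq_self t (Fin.init x)).symm
        · simp
    | cast c =>
      have hcne : (c : ℕ) ≠ n := Nat.ne_of_lt c.isLt
      cases t using Fin.lastCases with
      | last =>
        simp only [applyCX, Fin.val_castSucc, hcne, if_false, Fin.val_last, if_true, eval_node, eval_mix c,
          Function.update_self, Fin.init_update_last, Fin.init]
        rcases Bool.eq_false_or_eq_true (x (Fin.last n)) with hl | hl <;>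
          rcases Bool.eq_false_or_eq_true (x c.castSucc) with hc | hc <;> simp [hl, hc]
      | cast t =>
        have htne : (t : ℕ) ≠ n := Nat.ne_of_lt t.isLt
        have hlast : (Fin.last n) ≠ t.castSucc := (Fin.castSucc_lt_last t).ne'
        have hct' : c ≠ t := fun h => hct (by rw [h])
        simp only [applyCX, Fin.val_castSucc, hcne, htne, if_false, eval_node, eval_applyCX c t hct',
          Fin.init_update_castSucc, Function.update_of_ne hlast, Fin.init]

/-! ### The complex state vector of a tree, and its linear structure -/

/-- The complex state vector `x ↦ Σₖ cₖ(x) ωᵏ` of a tree of `ℤ[ω]`-coordinates. [folklore] -/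
def toState (v : Vec n) : QReg n → ℂ := fun x => Amp.eval omega (v.eval x)

/-- `toState`, pointwise. [folklore] -/
theorem toState_apply (v : Vec n) (x : QReg n) : v.toState x = Amp.eval omega (v.eval x) := rfl

/-- `toState` is additive. [folklore] -/
theorem toState_add (u v : Vec n) : (u + v).toState = u.toState + v.toState := by
  funext x
  simp [toState, eval_add]

/-- `toState` of a scalar multiple. [folklore] -/
theorem toState_smul (a : Amp) (v : Vec n) : (smul a v).toState = Amp.eval omega a • v.toState := by
  funext x
  simp [toState, eval_smul, Amp.eval_mul omega_pow_four]

/-- `toState` of the zero vector. [folklore] -/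
theorem toState_zero (n : ℕ) : (zero n).toState = 0 := by
  funext x
  simp [toState, eval_zero]

/-- `toState` of the vacuum tree is `|0ⁿ⟩`. [folklore] -/
theorem toState_vac (n : ℕ) : (vac n).toState = zeroState n := by
  funext x
  simp only [toState, eval_vac, zeroState, basisState_apply]
  split_ifs <;> simp

/-! ### Gate words and the faithfulness theorem -/

end Vec

/-- The gate symbols of the simulator: `H`, `S`, `T` on a wire, `CNOT` on two distinct wires.
[Nielsen–Chuang 2010, §4.2] [folklore] -/
inductive Op (n : ℕ)
  | H (k : Fin n)
  | S (k : Fin n)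
  | T (k : Fin n)
  | CX (c t : Fin n) (h : c ≠ t)

namespace Op

variable {n : ℕ}

/-- The tree's placed Clifford+`T` gate denoted by a symbol (`hOn`, `sOn`, `tOn`, `cnotOn`).
[folklore] -/
def toGate : Op n → QGate cliffordT n
  | H k => hOn k
  | S k => sOn k
  | T k => tOn k
  | CX c t h => cnotOn c t h

/-- The action of a symbol on trees (`H` scaled by `√2`). [folklore] -/
def apply : Op n → Vec n → Vec n
  | H k, v => v.applyH k
  | S k, v => v.applyS k
  | T k, v => v.applyT k
  | CX c t _, v => v.applyCX c t

/-- The scale of a symbol: `√2` for `H`, `1` otherwise. [folklore] -/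
def scale : Op n → ℂ
  | H _ => ((Real.sqrt 2 : ℝ) : ℂ)
  | S _ => 1
  | T _ => 1
  | CX _ _ _ => 1

/-- Is the symbol a Clifford gate (i.e. not `T`)? [folklore] -/
def isClifford : Op n → Bool
  | T _ => false
  | H _ => true
  | S _ => true
  | CX _ _ _ => true

/-- Denoted gates are oracle-free. [folklore] -/
theorem toGate_isOracleFree (o : Op n) : o.toGate.IsOracleFree := by
  cases o <;> trivial

/-- **Faithfulness for one gate**: the tree action is the (scaled) matrix action.
[Nielsen–Chuang 2010, §4.2] [folklore] -/
theorem toState_apply (A : Language Bool) (o : Op n) (v : Vec n) :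
    (o.apply v).toState = o.scale • (o.toGate.toMatrix A *ᵥ v.toState) := by
  funext x
  rw [← semZeta_omega A (toGate_isOracleFree o)]
  simp only [Pi.smul_apply, smul_eq_mul, Vec.toState_apply]
  cases o with
  | H k =>
    rw [show (H k).toGate = QGate.gate CliffordTOp.H (wireEmb k) from rfl, semZeta_mulVec_apply_H,
      apply, scale, Vec.eval_applyH, ← mul_assoc, sqrt2_mul_invSqrt2, one_mul]
    simp only [embH, wireEmb_apply, Vec.toState_apply]
    rcases Bool.eq_false_or_eq_true (x k) with hx | hx <;> simp [hx]
  | S k =>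
    rw [show (S k).toGate = QGate.gate CliffordTOp.S (wireEmb k) from rfl, semZeta_mulVec_apply_S,
      apply, scale, Vec.eval_applyS, one_mul]
    simp only [embS, wireEmb_apply, Vec.toState_apply]
    rcases Bool.eq_false_or_eq_true (x k) with hx | hx
    · simp only [hx, if_true, Amp.eval_mulOmega omega_pow_four, ← mul_assoc, ← pow_two, omega_pow_two]
    · simp [hx]
  | T k =>
    rw [show (T k).toGate = QGate.gate CliffordTOp.T (wireEmb k) from rfl, semZeta_mulVec_apply_T,
      apply, scale, Vec.eval_applyT, one_mul]
    simp only [embT, wireEmb_apply, Vec.toState_apply]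
    rcases Bool.eq_false_or_eq_true (x k) with hx | hx
    · simp only [hx, if_true, Amp.eval_mulOmega omega_pow_four]
    · simp [hx]
  | CX c t h =>
    rw [show (CX c t h).toGate = QGate.gate CliffordTOp.CNOT (pairEmb c t h) from rfl,
      semZeta_mulVec_apply_CNOT, apply, scale, Vec.eval_applyCX c t h, one_mul]
    simp only [embC, pairEmb_zero, pairEmb_one, Vec.toState_apply]

/-- The matrix of a Clifford symbol is a placement of a Clifford gate. [Aaronson–Gottesman 2004, §I]
[folklore] -/
theorem toMatrix_mem_cliffordCircuits (A : Language Bool) (o : Op n) (h : o.isClifford = true) :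
    o.toGate.toMatrix A ∈ cliffordCircuits n := by
  cases o with
  | H k => exact Submonoid.subset_closure ⟨CliffordOp.H, wireEmb k, rfl⟩
  | S k => exact Submonoid.subset_closure ⟨CliffordOp.S, wireEmb k, rfl⟩
  | T k => exact absurd h (by simp [isClifford])
  | CX c t hct => exact Submonoid.subset_closure ⟨CliffordOp.CNOT, pairEmb c t hct, rfl⟩

end Op

variable {n : ℕ}

/-- Run a gate word on a tree (head = first gate). [folklore] -/
def run : List (Op n) → Vec n → Vec n
  | [], v => v
  | o :: os, v => run os (o.apply v)

/-- The number of Hadamard symbols in a word (the exponent of the global factor `√2`). [folklore] -/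
def countH : List (Op n) → ℕ
  | [] => 0
  | Op.H _ :: os => countH os + 1
  | Op.S _ :: os => countH os
  | Op.T _ :: os => countH os
  | Op.CX _ _ _ :: os => countH os

/-- The tree circuit denoted by a word. [folklore] -/
def circuit (ops : List (Op n)) : QCircuit cliffordT n :=
  ⟨ops.map Op.toGate⟩

/-- **Faithfulness of the simulator**: running a word on a tree computes `√2^{#H}` times the
action of the denoted circuit on the denoted vector. [Nielsen–Chuang 2010, §4.5.5] [folklore] -/
theorem toState_run (A : Language Bool) : ∀ (ops : List (Op n)) (v : Vec n),
    (run ops v).toState = (((Real.sqrt 2 : ℝ) : ℂ) ^ countH ops) • ((circuit ops).toMatrix A *ᵥ v.toState)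
  | [], v => by simp [run, countH, circuit]
  | o :: os, v => by
    rw [run, toState_run A os (o.apply v), Op.toState_apply A, Matrix.mulVec_smul, smul_smul,
      Matrix.mulVec_mulVec]
    have hc : circuit (o :: os) = ⟨o.toGate :: (os.map Op.toGate)⟩ := rfl
    rw [hc, QCircuit.toMatrix_cons]
    cases o <;> simp [countH, Op.scale, circuit, pow_succ]

/-- The circuit of a `T`-free word is a Clifford circuit. [Aaronson–Gottesman 2004, §I] [folklore] -/
theorem toMatrix_circuit_mem (A : Language Bool) : ∀ (ops : List (Op n)),
    (∀ o ∈ ops, o.isClifford = true) → (circuit ops).toMatrix A ∈ cliffordCircuits n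
  | [], _ => by
    rw [show circuit ([] : List (Op n)) = ⟨[]⟩ from rfl, QCircuit.toMatrix_nil]
    exact Submonoid.one_mem _
  | o :: os, h => by
    have hc : circuit (o :: os) = ⟨o.toGate :: (os.map Op.toGate)⟩ := rfl
    rw [hc, QCircuit.toMatrix_cons]
    exact Submonoid.mul_mem _ (toMatrix_circuit_mem A os fun o' ho' => h o' (List.mem_cons_of_mem _ ho'))
      (Op.toMatrix_mem_cliffordCircuits A o (h o List.mem_cons_self))

/-- **A `T`-free word prepares a stabilizer state**: run on the vacuum tree, it denotes
`√2^{#H}` times a stabilizer state. [Aaronson–Gottesman 2004, Thm. 1] [folklore] -/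
theorem exists_stabilizer (ops : List (Op n)) (h : ∀ o ∈ ops, o.isClifford = true) :
    ∃ φ ∈ stabilizerStates n, (run ops (Vec.vac n)).toState = (((Real.sqrt 2 : ℝ) : ℂ) ^ countH ops) • φ :=
  ⟨(circuit ops).toMatrix 0 *ᵥ zeroState n, ⟨_, toMatrix_circuit_mem 0 ops h, rfl⟩,
    by rw [toState_run 0, Vec.toState_vac]⟩

/-! ### Linear combinations of trees -/

/-- `Σ_{i<m} dᵢ • Sᵢ` on trees. [folklore] -/
def lsum : (m : ℕ) → (Fin m → Amp) → (Fin m → Vec n) → Vec n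
  | 0, _, _ => Vec.zero n
  | m + 1, d, S => Vec.smul (d 0) (S 0) + lsum m (Fin.tail d) (Fin.tail S)

/-- `toState` of a linear combination of trees. [folklore] -/
theorem toState_lsum : ∀ (m : ℕ) (d : Fin m → Amp) (S : Fin m → Vec n),
    (lsum m d S).toState = ∑ i, Amp.eval omega (d i) • (S i).toState
  | 0, d, S => by simp [lsum, Vec.toState_zero]
  | m + 1, d, S => by
    rw [lsum, Vec.toState_add, Vec.toState_smul, toState_lsum m, Fin.sum_univ_succ]
    rfl

/-! ### The magic-state tree is `√2ⁿ |T⟩^{⊗n}` -/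

/-- `H|0⟩ = (|0⟩ + |1⟩)/√2`, as a function. [Nielsen–Chuang 2010, §1.3.1] [folklore] -/
theorem hGate_mulVec_zeroState : hGate *ᵥ zeroState 1 = fun _ => invSqrt2 := by
  funext x
  rw [zeroState, mulVec_basisState]
  exact hGate_apply_false x _ rfl

/-- The amplitudes of the magic state `|T⟩ = T H |0⟩ = (|0⟩ + ω|1⟩)/√2`.
[Bravyi–Gosset 2016, eq. (2)] [folklore] -/
theorem magicT_apply (y : QReg 1) : magicT y = invSqrt2 * (if y 0 = true then omega else 1) := by
  rw [magicT, hGate_mulVec_zeroState]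
  simp only [Matrix.mulVec, dotProduct]
  rw [Finset.sum_eq_single y, mul_comm]
  · simp [tGate]
  · intro j _ hj
    simp [tGate, Ne.symm hj]
  · simp

/-- One more tensor factor, pointwise: `ψ^{⊗(m+1)}(x) = ψ^{⊗m}(init x) · ψ(x_last)`. [folklore] -/
theorem tensorPow_succ_apply (ψ : QReg 1 → ℂ) (m : ℕ) (x : QReg (m + 1)) :
    tensorPow ψ (m + 1) x = tensorPow ψ m (Fin.init x) * ψ (fun _ => x (Fin.last m)) := by
  have hj : (fun j : Fin 1 => x (Fin.natAdd m j)) = fun _ => x (Fin.last m) := by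
    funext j
    rw [Subsingleton.elim j 0]
    rfl
  rw [tensorPow, ← hj]
  rfl

/-- **The magic tree is `√2ⁿ |T⟩^{⊗n}`.** [Bravyi–Smith–Smolin 2016, §IV] [folklore] -/
theorem toState_magic : ∀ n : ℕ, (Vec.magic n).toState = (((Real.sqrt 2 : ℝ) : ℂ) ^ n) • tensorPow magicT n
  | 0 => by
    funext x
    simp [Vec.toState, Vec.magic, tensorPow]
  | n + 1 => by
    funext x
    have ih := congrFun (toState_magic n) (Fin.init x)
    simp only [Vec.toState_apply, Pi.smul_apply, smul_eq_mul] at ih ⊢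
    rw [tensorPow_succ_apply, magicT_apply, Vec.eval_magic_succ]
    have hs := sqrt2_mul_invSqrt2
    cases x (Fin.last n)
    · simp only [Bool.false_eq_true, if_false, ih, mul_one, pow_succ]
      linear_combination (-(((Real.sqrt 2 : ℝ) : ℂ) ^ n * tensorPow magicT n (Fin.init x))) * hs
    · simp only [if_true, Amp.eval_mulOmega omega_pow_four, ih, pow_succ]
      linear_combination (-(((Real.sqrt 2 : ℝ) : ℂ) ^ n * tensorPow magicT n (Fin.init x) * omega)) * hs

/-! ### The Bravyi–Smith–Smolin decomposition of `|T⟩^{⊗6}` -/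

namespace BSS

/-- `CNOT` on two distinct literal wires of six. [folklore] -/
def cx (c t : Fin 6) (h : c ≠ t := by decide) : Op 6 := Op.CX c t h

/-- The word `H S S H` on wire `k` (`= 2·X` in the scaled arithmetic). [Nielsen–Chuang 2010,
Ex. 4.18] [folklore] -/
def xOps (k : Fin 6) : List (Op 6) := [Op.H k, Op.S k, Op.S k, Op.H k]

/-- The word `S S = Z` on wire `k`. [Nielsen–Chuang 2010, §4.2] [folklore] -/
def zOps (k : Fin 6) : List (Op 6) := [Op.S k, Op.S k]

/-- A fan of controlled-`Z` gates `∏_{i ∈ cs} CZ_{i j} = H_j (∏ CNOT_{i j}) H_j` (`= 2·∏ CZ` in the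
scaled arithmetic). [Nielsen–Chuang 2010, §4.3] [folklore] -/
def czFan (j : Fin 6) (cs : List (Fin 6)) : List (Op 6) :=
  Op.H j :: (cs.filterMap fun i => if h : i = j then none else some (Op.CX i j h)) ++ [Op.H j]

/-- The local Clifford `(H S³)^{⊗6}` (scaled), mapping `|H⟩^{⊗6}` to a multiple of `|T⟩^{⊗6}`.
[Bravyi–Smith–Smolin 2016, §IV] [folklore] -/
def vLayer : List (Op 6) :=
  [0, 1, 2, 3, 4, 5].flatMap fun k => [Op.S k, Op.S k, Op.S k, Op.H k]

/-- Preparation of `|E_6⟩ = Σ_{|x| even} |x⟩`: Hadamards on five wires, parity into the sixth.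
[Bravyi–Smith–Smolin 2016, §IV] [folklore] -/
def prepE : List (Op 6) :=
  [Op.H 0, Op.H 1, Op.H 2, Op.H 3, Op.H 4, cx 0 5, cx 1 5, cx 2 5, cx 3 5, cx 4 5]

/-- Preparation of `2|O_6⟩ = 2 Σ_{|x| odd} |x⟩`. [Bravyi–Smith–Smolin 2016, §IV] [folklore] -/
def prepO : List (Op 6) :=
  xOps 5 ++ prepE

/-- Preparation words (from `|0^6⟩`, scaled) of the seven states of eq. (11):
`|B_{6,0}⟩`, `2|B_{6,6}⟩`, `|E_6⟩`, `2|O_6⟩`, `2^5 Z^{⊗6}|K_6⟩`, `2^6|φ'⟩`, `2^6|φ''⟩`; the graphs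
`G'` (hub `6`, rim `1-2-3-4-5`) and `G''` (hub `3`, rim `1-2-4-5-6`) of Fig. 2, with vertices
`1…6` on wires `0…5`. [cite: BravyiSmithSmolin2016, §IV eq. (11) and Fig. 2] -/
def prep : Fin 7 → List (Op 6) :=
  ![[],
    xOps 0 ++ [cx 0 1, cx 0 2, cx 0 3, cx 0 4, cx 0 5],
    prepE,
    prepO,
    [Op.H 0, Op.H 1, Op.H 2, Op.H 3, Op.H 4, Op.H 5] ++ czFan 1 [0] ++ czFan 2 [0, 1] ++
      czFan 3 [0, 1, 2] ++ czFan 4 [0, 1, 2, 3] ++ czFan 5 [0, 1, 2, 3, 4] ++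
      ([0, 1, 2, 3, 4, 5].flatMap zOps),
    prepO ++ czFan 1 [0] ++ czFan 2 [1] ++ czFan 3 [2] ++ czFan 4 [3, 0] ++ czFan 5 [0, 1, 2, 3, 4],
    prepO ++ czFan 1 [0] ++ czFan 2 [0, 1] ++ czFan 3 [1, 2] ++ czFan 4 [3, 2] ++ czFan 5 [4, 0, 2]]

/-- The seven Clifford words: preparation followed by `(H S³)^{⊗6}`.
[cite: BravyiSmithSmolin2016, §IV eq. (11)] -/
def ops (i : Fin 7) : List (Op 6) :=
  prep i ++ vLayer

/-- The seven coefficients `dᵢ ∈ ℤ[ω]` (coordinates of `1, ω, ω², ω³`):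
`dᵢ = 2^{4 - pᵢ} (1+ω)^6 bᵢ` with `bᵢ` the printed coefficients of eq. (11) and `2^{pᵢ}` the scale
of the `i`-th preparation word. [cite: BravyiSmithSmolin2016, §IV eq. (11)] -/
def coef : Fin 7 → Amp :=
  ![⟨-256, 0, 256, 256⟩, ⟨128, 0, -128, 128⟩, ⟨0, 0, 0, 64⟩, ⟨-32, 0, 32, 0⟩, ⟨1, 0, -1, 0⟩,
    ⟨0, 0, 0, 1⟩, ⟨0, 0, 0, 1⟩]

/-- The global factor `2^{10}`. [folklore] -/
def scaleK : Amp := ⟨1024, 0, 0, 0⟩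

/-- **The seven-term identity, decided by the kernel**:
`2^{10} · (ω^{|x|})_x = Σ_{i<7} dᵢ · (ops i)|0^6⟩` in `ℤ[ω]^{64}`.
[cite: BravyiSmithSmolin2016, §IV eq. (11)] -/
theorem identity : Vec.smul scaleK (Vec.magic 6) = lsum 7 coef (fun i => run (ops i) (Vec.vac 6)) := by
  decide +kernel

/-- The seven words are `T`-free. [folklore] -/
theorem ops_clifford (i : Fin 7) : ∀ o ∈ ops i, o.isClifford = true := by
  fin_cases i <;> decide

/-- **`|T⟩^{⊗6}` is a linear combination of seven stabilizer states** (Bravyi–Smith–Smolin 2016,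
§IV eq. (11), transported by the local Clifford `(H S³)^{⊗6}`).
[cite: BravyiSmithSmolin2016, §IV eq. (11)] -/
theorem magicT_pow_six_decomposition :
    ∃ (c : Fin 7 → ℂ) (φ : Fin 7 → QReg 6 → ℂ),
      (∀ i, φ i ∈ stabilizerStates 6) ∧ tensorPow magicT 6 = ∑ i, c i • φ i := by
  choose φ hφ hS using fun i => exists_stabilizer (ops i) (ops_clifford i)
  have key := congrArg Vec.toState identity
  rw [Vec.toState_smul, toState_magic, toState_lsum] at key
  simp only [hS, smul_smul] at key
  set K : ℂ := Amp.eval omega scaleK * ((Real.sqrt 2 : ℝ) : ℂ) ^ 6 with hK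
  have hK0 : K ≠ 0 := by
    have h2 : ((Real.sqrt 2 : ℝ) : ℂ) ≠ 0 := by
      rw [Ne, Complex.ofReal_eq_zero]
      positivity
    have hs : Amp.eval omega scaleK = 1024 := by simp [Amp.eval, scaleK]
    rw [hK, hs]
    exact mul_ne_zero (by norm_num) (pow_ne_zero _ h2)
  refine ⟨fun i => K⁻¹ * (Amp.eval omega (coef i) * ((Real.sqrt 2 : ℝ) : ℂ) ^ countH (ops i)), φ, hφ, ?_⟩
  calc tensorPow magicT 6 = K⁻¹ • (K • tensorPow magicT 6) := by
        rw [smul_smul, inv_mul_cancel₀ hK0, one_smul]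
    _ = K⁻¹ • ∑ i, (Amp.eval omega (coef i) * ((Real.sqrt 2 : ℝ) : ℂ) ^ countH (ops i)) • φ i := by
        rw [hK, key]
    _ = ∑ i, (K⁻¹ * (Amp.eval omega (coef i) * ((Real.sqrt 2 : ℝ) : ℂ) ^ countH (ops i))) • φ i := by
        rw [Finset.smul_sum]
        simp only [smul_smul]

end BSS

end CliffordSim

/-! ### Discharge of `BravyiSmithSmolin2016_stabilizerRank_magicT_pow_six` -/

/-- **Discharge of `BravyiSmithSmolin2016_stabilizerRank_magicT_pow_six`: `χ(|T⟩^{⊗6}) ≤ 7`**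
(Bravyi–Smith–Smolin 2016, §I: "`χ₆ ≤ 7`"; §IV eq. (11): the explicit seven-term stabilizer
decomposition of `|H⟩^{⊗6}`, here transported to `|T⟩^{⊗6}` by the local Clifford `(H S³)^{⊗6}`
and verified exactly in `ℤ[ω]`-arithmetic, `CliffordSim.BSS.magicT_pow_six_decomposition`; the
seven stabilizer states witness the infimum defining `stabilizerRank`).
[cite: BravyiSmithSmolin2016, §I and §IV eq. (11)] -/
theorem BravyiSmithSmolin2016_stabilizerRank_magicT_pow_six_holds :
    BravyiSmithSmolin2016_stabilizerRank_magicT_pow_six := by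
  show stabilizerRank (tensorPow magicT 6) ≤ 7
  obtain ⟨c, φ, hφ, h⟩ := CliffordSim.BSS.magicT_pow_six_decomposition
  exact Nat.sInf_le ⟨c, φ, hφ, h⟩

end Literature.Computability.QuantumComplexity
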